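import Mathlib
import HarnessLib
import Literature.RepresentationTheory.CompactGroups.WeylIntegralFormula
import Summits.Ventures.LatticeQCDFlow.Exactness.SpectralKernelJacobianWeylShapeSU
import Summits.Ventures.LatticeQCDFlow.Exactness.SpectralKernelJacobianWeylShape

/-!
# The spectral kernel's Jacobian on `SU(n)` / `U(n)`, conditional on the NAMED Weyl integral formula

HONEST FRAMING: exact (Metropolis-corrected) sampling algorithms for lattice gauge theory;
figures of merit are autocorrelation/cost numbers at stated couplings and volumes; no
continuum-physics claim.

Venture `LatticeQCDFlow` (cell pub-lqcd), topic `Exactness`; FANOUT row 10 (`eng-equiv`).  NEW WORK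
of the cell: `SpectralKernelJacobianWeylShape[SU].lean` restated with the presentation hypothesis
`hW` replaced by the tree's NAMED FACT
`Literature.RepresentationTheory.CompactGroups.weylIntegralFormula_{specialUnitary,unitary}`
(Weyl's integral formula, Bröcker–tom Dieck IV (1.11), [cite]d there, NOT proved in the tree) —
the kernel-level companions of `SpectralCouplingLayerExactnessWeylFact.lean`.  CONDITIONAL on that
named fact; the torus Jacobian of the eigenvalue map and Boyda's identity stay explicit
hypotheses.  No number; no definition is introduced.

* **`hasJacobian_spectralKernel_specialUnitaryGroup_of_weylFact`** — `SU(n)`;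
* **`hasJacobian_spectralKernel_unitaryGroup_of_weylFact`** — `U(n)`.
-/

noncomputable section

namespace Summit.Ventures.LatticeQCDFlow.Exactness

open MeasureTheory Matrix Topology
open Literature.LinearAlgebra.Matrix
open Literature.MathematicalPhysics.QuantumFieldTheory
open Literature.RepresentationTheory.CompactGroups
open scoped ENNReal

variable {n : Type} [Fintype n] [DecidableEq n]

/-- **`SU(n)` spectral kernel: `HasJacobian (Haar SU(n)) h J`, CONDITIONAL on the named fact
`weylIntegralFormula_specialUnitary n`**, given the torus Jacobian `J_f` of the eigenvalue map
and Boyda's identity for `J`. -/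
theorem hasJacobian_spectralKernel_specialUnitaryGroup_of_weylFact
    (hW : weylIntegralFormula_specialUnitary n)
    {f : (n → ℂ) → (n → ℂ)} (hfc : ContinuousOn f {d | ∀ i, ‖d i‖ = 1})
    {h : Matrix.specialUnitaryGroup n ℂ → Matrix.specialUnitaryGroup n ℂ}
    (hagree : ∀ (P : Matrix.specialUnitaryGroup n ℂ) (V : Matrix n n ℂ) (d : n → ℂ),
      V ∈ Matrix.unitaryGroup n ℂ → (P : Matrix n n ℂ) = V * diagonal d * star V →
        ((h P : Matrix.specialUnitaryGroup n ℂ) : Matrix n n ℂ) = V * diagonal (f d) * star V)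
    {fT : specialDiagonalTorus n → specialDiagonalTorus n}
    (hfT : ∀ t : specialDiagonalTorus n, ((fT t : Matrix.specialUnitaryGroup n ℂ) : Matrix n n ℂ) =
      diagonal (f fun i => ((t : Matrix.specialUnitaryGroup n ℂ) : Matrix n n ℂ) i i))
    {Jf : specialDiagonalTorus n → ℝ≥0∞} (hfJ : HasJacobian (haarProbability (specialDiagonalTorus n)) fT Jf)
    {J : Matrix.specialUnitaryGroup n ℂ → ℝ≥0∞} (hJm : Measurable J)
    (hJ : ∀ (g : Matrix.specialUnitaryGroup n ℂ) (t : specialDiagonalTorus n),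
      J (g * (t : Matrix.specialUnitaryGroup n ℂ) * g⁻¹) * ENNReal.ofReal
          ((∏ i, ∏ j ∈ Finset.univ.erase i,
            ‖((t : Matrix.specialUnitaryGroup n ℂ) : Matrix n n ℂ) i i -
              ((t : Matrix.specialUnitaryGroup n ℂ) : Matrix n n ℂ) j j‖) / (Fintype.card n).factorial) =
        Jf t * ENNReal.ofReal
          ((∏ i, ∏ j ∈ Finset.univ.erase i,
            ‖((fT t : Matrix.specialUnitaryGroup n ℂ) : Matrix n n ℂ) i i -
              ((fT t : Matrix.specialUnitaryGroup n ℂ) : Matrix n n ℂ) j j‖) / (Fintype.card n).factorial)) :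
    HasJacobian (haarProbability (Matrix.specialUnitaryGroup n ℂ)) h J :=
  hasJacobian_spectralKernel_specialUnitaryGroup_of_weyl hW hfc hagree hfT hfJ hJm hJ

/-- **`U(n)` spectral kernel: `HasJacobian (Haar U(n)) h J`, CONDITIONAL on the named fact
`weylIntegralFormula_unitary n`.** -/
theorem hasJacobian_spectralKernel_unitaryGroup_of_weylFact
    (hW : weylIntegralFormula_unitary n)
    {f : (n → ℂ) → (n → ℂ)} (hfc : ContinuousOn f {d | ∀ i, ‖d i‖ = 1})
    {h : Matrix.unitaryGroup n ℂ → Matrix.unitaryGroup n ℂ}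
    (hagree : ∀ (P : Matrix.unitaryGroup n ℂ) (V : Matrix n n ℂ) (d : n → ℂ),
      V ∈ Matrix.unitaryGroup n ℂ → (P : Matrix n n ℂ) = V * diagonal d * star V →
        ((h P : Matrix.unitaryGroup n ℂ) : Matrix n n ℂ) = V * diagonal (f d) * star V)
    {fT : diagonalTorus n → diagonalTorus n}
    (hfT : ∀ t : diagonalTorus n, ((fT t : Matrix.unitaryGroup n ℂ) : Matrix n n ℂ) =
      diagonal (f fun i => ((t : Matrix.unitaryGroup n ℂ) : Matrix n n ℂ) i i))
    {Jf : diagonalTorus n → ℝ≥0∞} (hfJ : HasJacobian (haarProbability (diagonalTorus n)) fT Jf)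
    {J : Matrix.unitaryGroup n ℂ → ℝ≥0∞} (hJm : Measurable J)
    (hJ : ∀ (g : Matrix.unitaryGroup n ℂ) (t : diagonalTorus n),
      J (g * (t : Matrix.unitaryGroup n ℂ) * g⁻¹) * ENNReal.ofReal
          ((∏ i, ∏ j ∈ Finset.univ.erase i,
            ‖((t : Matrix.unitaryGroup n ℂ) : Matrix n n ℂ) i i -
              ((t : Matrix.unitaryGroup n ℂ) : Matrix n n ℂ) j j‖) / (Fintype.card n).factorial) =
        Jf t * ENNReal.ofReal
          ((∏ i, ∏ j ∈ Finset.univ.erase i,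
            ‖((fT t : Matrix.unitaryGroup n ℂ) : Matrix n n ℂ) i i -
              ((fT t : Matrix.unitaryGroup n ℂ) : Matrix n n ℂ) j j‖) / (Fintype.card n).factorial)) :
    HasJacobian (haarProbability (Matrix.unitaryGroup n ℂ)) h J :=
  hasJacobian_spectralKernel_unitaryGroup_of_weyl hW hfc hagree hfT hfJ hJm hJ

end Summit.Ventures.LatticeQCDFlow.Exactness
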